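import Summits.AtomisticToContinuum.BoseEinsteinCondensation.Theses.BECIntegerBlockRotor


/-!
# Crux `BlockInfraredBound` (stmt-AtomisticToContinuum-13593) — `Lines/birth.lean`

BC3 birth skeleton for the rank-3 crux of route `BECIntegerBlockRotor`
(sub-problem `BoseEinsteinCondensation`): the box-uniform T = 0 INFRARED BOUND FOR BLOCK PLANE WAVES,
`n(f_q) = cellOccupation N L f_q Ψ ≤ C/√ε(q)` for every periodic δ-near-minimiser `Ψ`, every even
`K` with `K³ ∣ N` and block side `L/K ∈ [A, 2A]·(N/L³)^(-1/2)`, and every `q ≢ 0 (mod K)`, where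
`f_q(x) = L^(-3/2) exp(2πi q·⌊Kx/L⌋/K)` and `ε(q) = Σ_j (1 - cos(2π q_j/K))`.

## The line: ONE-SIDED KENNEDY–LIEB–SHASTRY TRANSFER (annihilation side only)

Write `A = a(f_q)` for the annihilation of the block wave, acting on an `(N+1)`-particle state `Ψ`:
`(AΨ)(Y) = √(N+1) ∫_cell conj(f_q(x)) Ψ(x, Y) dx`, an `N`-particle function with `‖AΨ‖² = n(f_q)`.
For ANY vector `u` and any positive form `T` one has `‖u‖⁴ ≤ ⟨u, T⁻¹u⟩ · ⟨u, Tu⟩`; with `u = AΨ`,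
`T = H_N - E₀(N) + θ` (`θ = ε(q)/l²`, `l = L/K`) this reads

  `n(f_q)² ≤ b₋(q) · (c₋(q) + θ·n(f_q))`,   `c₋(q) := Q_N(AΨ) - E₀(N)·n(f_q)`,

where `b₋` is the annihilation half of the two-sided static susceptibility of the route's crux #2
`BlockSusceptibilityBound` (a supremum over `N`-particle trial states, verbatim) and `Q_N` is the
periodic `N`-body energy form. Only the ANNIHILATION side is needed to bound `n(f_q) = ‖AΨ‖²`
(KLS use both sides because Gaussian domination delivers the symmetrised susceptibility; we simply
discard `‖A*Ψ‖²`). This matters: the creation-side commutator `c₊` contains `⟨f_q, -Δ f_q⟩ = +∞` for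
the SHARP block wave, which is what makes the two-sided transfer (support item `KLSTransfer`) an XL
smoothing exercise, whereas `c₋` is finite for sharp waves — `AΨ` is differentiated only in the
spectator variables `Y` — and Bogoliubov theory predicts `c₋ ≈ Σ_k |f̂_q(k)|² n_k e_k ≈ 4πaρ·O(1)
= O(a A²)/l²` per mode (`n_k e_k → μ/2` as `k → 0`). Hence three stubs:

* `stub_blockSusceptibility` — the route's own engine, crux #2 `BlockSusceptibilityBound` BY NAME
  (Gaussian domination for the blocked gas: `b₋ + b₊ ≤ C_b l²/ε(q)`; open problem, rank 2, staffed on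
  its own item stmt-AtomisticToContinuum-13592). Used only through `b₋ ≤ b₋ + b₊`.
* `stub_annihilationEnergy` — NEW, the load-bearing analytic stub (size L/XL): the one-sided
  "phonon f-sum" bound `Q_N(a(f_q)Ψ) ≤ E₀(N)·n(f_q) + C_c/l²` for δ-near-minimisers of dilute boxes
  in the block window, for EVERY block constant `A` (constants depending on `v, A`), together with the
  finiteness `E₀(N+1, L) < ∞` of the dilute boxes it speaks about. Removing one particle through a
  coarse mode from a near-ground state costs `O(1/l²)` of `N`-body energy above `n·E₀(N)`: no
  derivative of `f_q` enters. Why it might fail: for near-minimisers (not eigenvectors) the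
  eigenvector identity `c₋ + c₊ = ⟨[A*, [H, A]]⟩ + μ₋·n - μ₊·(n+1)` (`μ₋ = E₀(N+1) - E₀(N)`,
  `μ₊ = E₀(N+2) - E₀(N+1)`) is unavailable and `c₋` must be controlled directly (δ after `N, L`
  helps: δ-near-minimisers converge to the ground space at fixed `N, L`); hard cores need the
  Jastrow-type insertion of the route's `KLSTransfer` note; uniformity in `K ≥ 2` and `ρ < ρ₀`.
* `stub_oneSidedKLS` — the variational Cauchy–Schwarz inequality above in the trial-state formalism
  (size M, provable now: the only analytic content is that `AΨ/‖AΨ‖` is an admissible periodic trial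
  state — `C¹` by differentiation under the integral over the compact cell, periodic, Bose-symmetric —
  with energy `Q_N(AΨ)/n`, plus `n(f_q) < ∞` for finite-energy `Ψ`). Stated for all `Ψ` of finite
  energy, all `K > 0`, `q`, and every real regulariser `t > 0`.

`BlockInfraredBound_of : stub₁-sig → stub₂-sig → stub₃-sig → BlockInfraredBound` is a REAL PROOF
(no `sorry`; stub sigs 2–3 spelled by their registered-name aliases `__Registered.stub_X`, see below): re-index `N = M + 1` (the crux speaks of `N`-particle states, #2 of `(N+1)`-particle
ones), `A :=` the block constant of #2, `ρ₀ := min`, `N₀ := max + 1`, `δ := min δ_b δ_c 1`; then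
`n² ≤ b₋ (c₋ + θ n) ≤ (C_b l²/ε)(C_c/l² + (ε/l²) n) = C_bC_c/ε + C_b n` in `ℝ≥0∞`
(`ennreal_step`), whence `n ≤ C_b + √(C_bC_c/ε) ≤ (√6 C_b + √(C_b C_c))/√ε(q)` using
`0 < ε(q) ≤ 6` (`real_step`, `eps_pos`, `eps_le_six`; `ε(q) > 0` is exactly `q ≢ 0 mod K` via
`Real.cos_eq_one_iff`). `BlockInfraredBound_of_stubs : BlockInfraredBound` applies it to the stubs.

Why this is not shredding: no stub is the crux — #2 is a susceptibility (resolvent) bound whose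
transfer to occupations is the open support item `KLSTransfer`; the energy stub bounds an `N`-body
energy form, not an occupation; the Cauchy–Schwarz stub holds for every state and carries no
smallness. None mentions `λ_max`/`HasGroundStateBEC` (probes `stub → BoseEinsteinCondensation` fail).
Disproof used: none on file (`ledger crux ls stmt-AtomisticToContinuum-13593`: no `Disproof.lean`,
no prior lines). Negatives index: no BEC entry is an instance of a stub (checked 2026-08-17).
Degenerate cases: `v ≡ 0` — #2 holds with `C = 1` (route header), the energy stub holds with any
`C` once `δ ≤ C/((N+1)l²)` (then `Q_N(AΨ) ≤ (N+1)·δ`, `E₀ = 0`), the KLS stub is a theorem; `q ≡ 0`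
is excluded everywhere (there `ε = 0` and `ofReal (C/√0) = 0`).
-/

namespace Summit.AtomisticToContinuum.BoseEinsteinCondensation.Cruxes.BlockInfraredBound.Birth

open MeasureTheory
open scoped ENNReal


/-! ### The three stubs -/

/-- STUB 1 — the route's inter-block engine, crux #2 `BlockSusceptibilityBound` BY NAME (item
stmt-AtomisticToContinuum-13592, rank 2, open problem): GAUSSIAN DOMINATION FOR THE BLOCKED GAS,
`b₋(q) + b₊(q) ≤ C (L/K)²/ε(q)` for the two-sided static susceptibility of `a(f_q) + a(f_q)*` in every
δ-near-minimiser of a dilute `(N+1)`-particle periodic box at integer block filling, `q ≢ 0 mod K`.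
Mechanism: exact RP/GD of the integer-filled block rotor array (in tree: `QuantumRotorTruncatedGD`,
`Matrix.kls_groundEnergy_reflection`) + stability under the RP-spoiling corrections. The line uses
only its annihilation half `b₋ ≤ b₋ + b₊`. [cite: KLS1988JSP; DysonLiebSimon1978; WojtkiewiczPuszStachura2016] -/
theorem stub_blockSusceptibility :
    Summit.AtomisticToContinuum.BoseEinsteinCondensation.Theses.BECIntegerBlockRotor.BlockSusceptibilityBound := by
  sorry

/-- STUB 2 — ONE-SIDED PHONON ENERGY ("annihilation f-sum") BOUND, the load-bearing analytic stub
(size L/XL). For every repulsive finite-range `v` and EVERY block constant `A > 0` there are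
`ρ₀, C, N₀` such that every dilute box (`N ≥ N₀`, `N + 1 ≤ ρ₀L³`) has finite periodic ground-state
energy `E₀(N+1, L) < ∞` and some `δ > 0` with: for every δ-near-minimiser `Ψ` of the `(N+1)`-body
periodic energy, every even `K > 0` with `K³ ∣ N+1` and `L/K ∈ [A, 2A]·((N+1)/L³)^(-1/2)`, and every
`q ≢ 0 mod K`, the `N`-body energy form of the contracted function
`(a(f_q)Ψ)(Y) = √(N+1) ∫_cell conj(f_q(x)) Ψ(x, Y) dx` satisfies
`Q_N(a(f_q)Ψ) ≤ E₀(N, L) · n(f_q) + C/(L/K)²` (`n(f_q) = ‖a(f_q)Ψ‖² = cellOccupation (N+1) L f_q Ψ`).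
For an exact ground state `Q_N(a(f_q)Ψ) - E₀(N)·n = c₋ = ⟨a(f_q)Ψ, (H_N - E₀(N)) a(f_q)Ψ⟩`, the
annihilation-side member of the KLS pair `(c₋, c₊)` whose sum is the double commutator
`⟨[a(f_q)*, [H, a(f_q)]]⟩` up to the chemical-potential terms `μ₋·n - μ₊·(n+1)`; no derivative of the
(sharp) block wave enters, since `a(f_q)Ψ` is differentiated only in the spectator variables. Bogoliubov: `c₋ ≈ Σ_k |f̂_q(k)|² n_k e_k` with `n_k e_k → μ/2 = 4πaρ` as `k → 0`, i.e.
`c₋ = O(aρ) = O(a A²)/l²` at block side `l ≤ 2A ρ^(-1/2)`. Why it might fail: near-minimisers are not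
eigenvectors (`c₋` must be bounded without the double-commutator identity; δ is chosen after `N, L`);
hard cores; uniformity in `K ≥ 2` and in `ρ < ρ₀`. [cite: KLS1988JSP; KLS1988PRL; LSSY2005, Thm 5.1 and App. A] -/
theorem stub_annihilationEnergy :
    ∀ v : ℝ → ENNReal, Literature.MathematicalPhysics.QuantumManyBody.BoseGas.IsRepulsiveFiniteRange v → ∀ A : ℝ, 0 < A → ∃ ρ₀ : ℝ, 0 < ρ₀ ∧ ∃ C : ℝ, 0 < C ∧ ∃ N₀ : ℕ, ∀ (N : ℕ) (L : ℝ), 0 < L → N₀ ≤ N → (N : ℝ) + 1 ≤ ρ₀ * L ^ 3 → ∃ δ : ENNReal, 0 < δ ∧ Literature.MathematicalPhysics.QuantumManyBody.BoseGas.periodicGroundStateEnergy v (N + 1) L ≠ ⊤ ∧ ∀ Ψ : Literature.MathematicalPhysics.QuantumManyBody.BoseGas.PeriodicTrialState (N + 1) L, Literature.MathematicalPhysics.QuantumManyBody.BoseGas.periodicEnergy v Ψ ≤ Literature.MathematicalPhysics.QuantumManyBody.BoseGas.periodicGroundStateEnergy v (N + 1) L + δ → ∀ K : ℕ, Even K →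 0 < K → K ^ 3 ∣ (N + 1) → A / Real.sqrt (((N : ℝ) + 1) / L ^ 3) ≤ L / (K : ℝ) ∧ L / (K : ℝ) ≤ 2 * A / Real.sqrt (((N : ℝ) + 1) / L ^ 3) → ∀ q : Fin 3 → ℤ, ¬ (∀ j : Fin 3, (K : ℤ) ∣ q j) → (∫⁻ Y in Literature.MathematicalPhysics.QuantumManyBody.BoseGas.cellN N L, Literature.MathematicalPhysics.QuantumManyBody.BoseGas.kineticDensity (fun Y' : Fin N → EuclideanSpace ℝ (Fin 3) => ((Real.sqrt ((N : ℝ) + 1) : ℝ) : ℂ) * ∫ x in Literature.MathematicalPhysics.QuantumManyBody.BoseGas.cell L, (starRingEnd ℂ) ((((Real.sqrt (L ^ 3))⁻¹ : ℝ) : ℂ) * Complex.exp (((2 * Real.pi * (∑ j : Fin 3, (q j : ℝ) * (⌊(K : ℝ) * x j / L⌋ : ℝ)) / (K : ℝ) : ℝ) : ℂ) * Complex.I)) * Ψ.ψ (Matrix.vecCons x Y')) Y + Literature.MathematicalPhysics.QuantumManyBody.BoseGas.periodicInteraction v L Y * (‖((Real.sqrt ((N : ℝ) + 1) : ℝ)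 : ℂ) * ∫ x in Literature.MathematicalPhysics.QuantumManyBody.BoseGas.cell L, (starRingEnd ℂ) ((((Real.sqrt (L ^ 3))⁻¹ : ℝ) : ℂ) * Complex.exp (((2 * Real.pi * (∑ j : Fin 3, (q j : ℝ) * (⌊(K : ℝ) * x j / L⌋ : ℝ)) / (K : ℝ) : ℝ) : ℂ) * Complex.I)) * Ψ.ψ (Matrix.vecCons x Y)‖₊ : ENNReal) ^ 2) ≤ Literature.MathematicalPhysics.QuantumManyBody.BoseGas.periodicGroundStateEnergy v N L * Literature.MathematicalPhysics.QuantumManyBody.BoseGas.cellOccupation (N + 1) L (fun x : EuclideanSpace ℝ (Fin 3) => (((Real.sqrt (L ^ 3))⁻¹ : ℝ) : ℂ) * Complex.exp (((2 * Real.pi * (∑ j : Fin 3, (q j : ℝ) * (⌊(K : ℝ) * x j / L⌋ : ℝ)) / (K : ℝ) : ℝ) : ℂ) * Complex.I)) Ψ.ψ + ENNReal.ofReal (C / (L / (K : ℝ)) ^ 2) := by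
  sorry

/-- STUB 3 — ONE-SIDED VARIATIONAL KLS (Cauchy–Schwarz) INEQUALITY in the trial-state formalism
(size M, provable now). For every `v`, every box `L > 0`, every `(N+1)`-particle periodic trial state
`Ψ` of finite energy, every `K > 0`, `q`, and every real regulariser `t > 0`:
`n(f_q) < ∞` and `n(f_q)² ≤ b₋(t) · (Q_N(a(f_q)Ψ) - E₀(N, L)·n(f_q) + t·n(f_q))`, where
`b₋(t) = sup_Φ |⟨Φ, a(f_q)Ψ⟩|² / (E(Φ) - E₀(N, L) + t)` over `N`-particle periodic trial states `Φ`
(the annihilation half of crux #2's susceptibility, verbatim, with regulariser `t`). Proof sketch: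
if `n = 0` trivial; else `Φ₀ := a(f_q)Ψ/√n` is an admissible trial state (`C¹` by differentiation
under the integral over the compact cell, `Lℤ³`-periodic, Bose-symmetric, normalised) with
`E(Φ₀) = Q_N(a(f_q)Ψ)/n ≥ E₀(N, L)`, and the `Φ₀` term of the supremum equals
`n² / (Q_N - E₀ n + t n)`; finiteness from `|∫ conj(f_q) Ψ|² ≤ ∫_cell |f_q|² ∫_cell |Ψ|²`. This is
the abstract `‖u‖⁴ ≤ ⟨u, T⁻¹u⟩⟨u, Tu⟩` with `T = H_N - E₀(N) + t`, `u = a(f_q)Ψ`, and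
`⟨u, T⁻¹u⟩ = sup_Φ |⟨Φ, u⟩|²/⟨Φ, TΦ⟩`. [cite: KLS1988JSP, proof of the T = 0 infrared bound; folklore] -/
theorem stub_oneSidedKLS :
    ∀ (v : ℝ → ENNReal) (N : ℕ) (L : ℝ), 0 < L → ∀ Ψ : Literature.MathematicalPhysics.QuantumManyBody.BoseGas.PeriodicTrialState (N + 1) L, Literature.MathematicalPhysics.QuantumManyBody.BoseGas.periodicEnergy v Ψ ≠ ⊤ → ∀ K : ℕ, 0 < K → ∀ (q : Fin 3 → ℤ) (t : ℝ), 0 < t → Literature.MathematicalPhysics.QuantumManyBody.BoseGas.cellOccupation (N + 1) L (fun x : EuclideanSpace ℝ (Fin 3) => (((Real.sqrt (L ^ 3))⁻¹ : ℝ) : ℂ) * Complex.exp (((2 * Real.pi * (∑ j : Fin 3, (q j : ℝ) * (⌊(K : ℝ) * x j / L⌋ : ℝ)) / (K : ℝ) : ℝ) : ℂ) * Complex.I)) Ψ.ψ ≠ ⊤ ∧ Literature.MathematicalPhysics.QuantumManyBody.BoseGas.cellOccupation (N + 1) L (fun x : EuclideanSpace ℝ (Fin 3) => (((Real.sqrt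 (L ^ 3))⁻¹ : ℝ) : ℂ) * Complex.exp (((2 * Real.pi * (∑ j : Fin 3, (q j : ℝ) * (⌊(K : ℝ) * x j / L⌋ : ℝ)) / (K : ℝ) : ℝ) : ℂ) * Complex.I)) Ψ.ψ ^ 2 ≤ (⨆ Φ : Literature.MathematicalPhysics.QuantumManyBody.BoseGas.PeriodicTrialState N L, ENNReal.ofReal (‖((Real.sqrt ((N : ℝ) + 1) : ℝ) : ℂ) * ∫ Y in Literature.MathematicalPhysics.QuantumManyBody.BoseGas.cellN N L, (starRingEnd ℂ) (Φ.ψ Y) * (∫ x in Literature.MathematicalPhysics.QuantumManyBody.BoseGas.cell L, (starRingEnd ℂ) ((((Real.sqrt (L ^ 3))⁻¹ : ℝ) : ℂ) * Complex.exp (((2 * Real.pi * (∑ j : Fin 3, (q j : ℝ) * (⌊(K : ℝ) * x j / L⌋ : ℝ)) / (K : ℝ) : ℝ) : ℂ) * Complex.I)) * Ψ.ψ (Matrix.vecCons x Y))‖ ^ 2) / (Literature.MathematicalPhysics.QuantumManyBody.BoseGas.periodicEnergy v Φ - Literature.MathematicalPhysics.QuantumManyBody.BoseGas.periodicGroundStateEnergy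 v N L + ENNReal.ofReal t)) * ((∫⁻ Y in Literature.MathematicalPhysics.QuantumManyBody.BoseGas.cellN N L, Literature.MathematicalPhysics.QuantumManyBody.BoseGas.kineticDensity (fun Y' : Fin N → EuclideanSpace ℝ (Fin 3) => ((Real.sqrt ((N : ℝ) + 1) : ℝ) : ℂ) * ∫ x in Literature.MathematicalPhysics.QuantumManyBody.BoseGas.cell L, (starRingEnd ℂ) ((((Real.sqrt (L ^ 3))⁻¹ : ℝ) : ℂ) * Complex.exp (((2 * Real.pi * (∑ j : Fin 3, (q j : ℝ) * (⌊(K : ℝ) * x j / L⌋ : ℝ)) / (K : ℝ) : ℝ) : ℂ) * Complex.I)) * Ψ.ψ (Matrix.vecCons x Y')) Y + Literature.MathematicalPhysics.QuantumManyBody.BoseGas.periodicInteraction v L Y * (‖((Real.sqrt ((N : ℝ) + 1) : ℝ) : ℂ) * ∫ x in Literature.MathematicalPhysics.QuantumManyBody.BoseGas.cell L, (starRingEnd ℂ) ((((Real.sqrt (L ^ 3))⁻¹ : ℝ) : ℂ) * Complex.exp (((2 * Real.pi * (∑ j : Fin 3, (q j : ℝ) * (⌊(K : ℝ) * x j / L⌋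 : ℝ)) / (K : ℝ) : ℝ) : ℂ) * Complex.I)) * Ψ.ψ (Matrix.vecCons x Y)‖₊ : ENNReal) ^ 2) - Literature.MathematicalPhysics.QuantumManyBody.BoseGas.periodicGroundStateEnergy v N L * Literature.MathematicalPhysics.QuantumManyBody.BoseGas.cellOccupation (N + 1) L (fun x : EuclideanSpace ℝ (Fin 3) => (((Real.sqrt (L ^ 3))⁻¹ : ℝ) : ℂ) * Complex.exp (((2 * Real.pi * (∑ j : Fin 3, (q j : ℝ) * (⌊(K : ℝ) * x j / L⌋ : ℝ)) / (K : ℝ) : ℝ) : ℂ) * Complex.I)) Ψ.ψ + ENNReal.ofReal t * Literature.MathematicalPhysics.QuantumManyBody.BoseGas.cellOccupation (N + 1) L (fun x : EuclideanSpace ℝ (Fin 3) => (((Real.sqrt (L ^ 3))⁻¹ : ℝ) : ℂ) * Complex.exp (((2 * Real.pi * (∑ j : Fin 3, (q j : ℝ) * (⌊(K : ℝ) * x j / L⌋ : ℝ)) / (K : ℝ) : ℝ) : ℂ) * Complex.I)) Ψ.ψ) := by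
  sorry

/-! ### Registered-name aliases of the stub statements

The native skeleton audit (`#h21_check_skeleton`, run by `ledger skeleton check`) admits a `Prop`
hypothesis of the skeleton theorem only if its HEAD CONSTANT is a registered obligation (stub 1 is the
route item `BlockSusceptibilityBound`, crux #2, by name) or is NAMED like a declared stub. A verbatim
`∀ …` signature has no head constant, so stubs 2–3 enter `BlockInfraredBound_of` through the aliases
below: `__Registered.stub_X` is the statement of `stub_X`, character for character, under that name
(reducible, definitionally equal — `BlockInfraredBound_of_stubs` feeds the theorems `stub_X` straight
in). The `__` namespace is an implementation detail skipped by the audit's declaration scan, so the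
registered stubs remain the sorried THEOREMS `stub_X` with their full self-contained signatures (same
device as `Cruxes/AmplitudeLDP/Lines/birth.lean` in this sub-problem). -/
namespace __Registered

/-- The statement of `stub_annihilationEnergy`, verbatim, keyed by the registered stub name. -/
abbrev stub_annihilationEnergy : Prop :=
    ∀ v : ℝ → ENNReal, Literature.MathematicalPhysics.QuantumManyBody.BoseGas.IsRepulsiveFiniteRange v → ∀ A : ℝ, 0 < A → ∃ ρ₀ : ℝ, 0 < ρ₀ ∧ ∃ C : ℝ, 0 < C ∧ ∃ N₀ : ℕ, ∀ (N : ℕ) (L : ℝ), 0 < L → N₀ ≤ N → (N : ℝ) + 1 ≤ ρ₀ * L ^ 3 → ∃ δ : ENNReal, 0 < δ ∧ Literature.MathematicalPhysics.QuantumManyBody.BoseGas.periodicGroundStateEnergy v (N + 1) L ≠ ⊤ ∧ ∀ Ψ : Literature.MathematicalPhysics.QuantumManyBody.BoseGas.PeriodicTrialState (N + 1) L, Literature.MathematicalPhysics.QuantumManyBody.BoseGas.periodicEnergy v Ψ ≤ Literature.MathematicalPhysics.QuantumManyBody.BoseGas.periodicGroundStateEnergy v (N + 1) L + δ → ∀ K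 : ℕ, Even K → 0 < K → K ^ 3 ∣ (N + 1) → A / Real.sqrt (((N : ℝ) + 1) / L ^ 3) ≤ L / (K : ℝ) ∧ L / (K : ℝ) ≤ 2 * A / Real.sqrt (((N : ℝ) + 1) / L ^ 3) → ∀ q : Fin 3 → ℤ, ¬ (∀ j : Fin 3, (K : ℤ) ∣ q j) → (∫⁻ Y in Literature.MathematicalPhysics.QuantumManyBody.BoseGas.cellN N L, Literature.MathematicalPhysics.QuantumManyBody.BoseGas.kineticDensity (fun Y' : Fin N → EuclideanSpace ℝ (Fin 3) => ((Real.sqrt ((N : ℝ) + 1) : ℝ) : ℂ) * ∫ x in Literature.MathematicalPhysics.QuantumManyBody.BoseGas.cell L, (starRingEnd ℂ) ((((Real.sqrt (L ^ 3))⁻¹ : ℝ) : ℂ) * Complex.exp (((2 * Real.pi * (∑ j : Fin 3, (q j : ℝ) * (⌊(K : ℝ) * x j / L⌋ : ℝ)) / (K : ℝ) : ℝ) : ℂ) * Complex.I)) * Ψ.ψ (Matrix.vecCons x Y')) Y + Literature.MathematicalPhysics.QuantumManyBody.BoseGas.periodicInteraction v L Y * (‖((Real.sqrt ((N : ℝ)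 + 1) : ℝ) : ℂ) * ∫ x in Literature.MathematicalPhysics.QuantumManyBody.BoseGas.cell L, (starRingEnd ℂ) ((((Real.sqrt (L ^ 3))⁻¹ : ℝ) : ℂ) * Complex.exp (((2 * Real.pi * (∑ j : Fin 3, (q j : ℝ) * (⌊(K : ℝ) * x j / L⌋ : ℝ)) / (K : ℝ) : ℝ) : ℂ) * Complex.I)) * Ψ.ψ (Matrix.vecCons x Y)‖₊ : ENNReal) ^ 2) ≤ Literature.MathematicalPhysics.QuantumManyBody.BoseGas.periodicGroundStateEnergy v N L * Literature.MathematicalPhysics.QuantumManyBody.BoseGas.cellOccupation (N + 1) L (fun x : EuclideanSpace ℝ (Fin 3) => (((Real.sqrt (L ^ 3))⁻¹ : ℝ) : ℂ) * Complex.exp (((2 * Real.pi * (∑ j : Fin 3, (q j : ℝ) * (⌊(K : ℝ) * x j / L⌋ : ℝ)) / (K : ℝ) : ℝ) : ℂ) * Complex.I)) Ψ.ψ + ENNReal.ofReal (C / (L / (K : ℝ)) ^ 2)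

/-- The statement of `stub_oneSidedKLS`, verbatim, keyed by the registered stub name. -/
abbrev stub_oneSidedKLS : Prop :=
    ∀ (v : ℝ → ENNReal) (N : ℕ) (L : ℝ), 0 < L → ∀ Ψ : Literature.MathematicalPhysics.QuantumManyBody.BoseGas.PeriodicTrialState (N + 1) L, Literature.MathematicalPhysics.QuantumManyBody.BoseGas.periodicEnergy v Ψ ≠ ⊤ → ∀ K : ℕ, 0 < K → ∀ (q : Fin 3 → ℤ) (t : ℝ), 0 < t → Literature.MathematicalPhysics.QuantumManyBody.BoseGas.cellOccupation (N + 1) L (fun x : EuclideanSpace ℝ (Fin 3) => (((Real.sqrt (L ^ 3))⁻¹ : ℝ) : ℂ) * Complex.exp (((2 * Real.pi * (∑ j : Fin 3, (q j : ℝ) * (⌊(K : ℝ) * x j / L⌋ : ℝ)) / (K : ℝ) : ℝ) : ℂ) * Complex.I)) Ψ.ψ ≠ ⊤ ∧ Literature.MathematicalPhysics.QuantumManyBody.BoseGas.cellOccupation (N + 1) L (fun x : EuclideanSpace ℝ (Fin 3) => (((Real.sqrt (L ^ 3))⁻¹ : ℝ) : ℂ) * Complex.exp (((2 * Real.pi *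 (∑ j : Fin 3, (q j : ℝ) * (⌊(K : ℝ) * x j / L⌋ : ℝ)) / (K : ℝ) : ℝ) : ℂ) * Complex.I)) Ψ.ψ ^ 2 ≤ (⨆ Φ : Literature.MathematicalPhysics.QuantumManyBody.BoseGas.PeriodicTrialState N L, ENNReal.ofReal (‖((Real.sqrt ((N : ℝ) + 1) : ℝ) : ℂ) * ∫ Y in Literature.MathematicalPhysics.QuantumManyBody.BoseGas.cellN N L, (starRingEnd ℂ) (Φ.ψ Y) * (∫ x in Literature.MathematicalPhysics.QuantumManyBody.BoseGas.cell L, (starRingEnd ℂ) ((((Real.sqrt (L ^ 3))⁻¹ : ℝ) : ℂ) * Complex.exp (((2 * Real.pi * (∑ j : Fin 3, (q j : ℝ) * (⌊(K : ℝ) * x j / L⌋ : ℝ)) / (K : ℝ) : ℝ) : ℂ) * Complex.I)) * Ψ.ψ (Matrix.vecCons x Y))‖ ^ 2) / (Literature.MathematicalPhysics.QuantumManyBody.BoseGas.periodicEnergy v Φ - Literature.MathematicalPhysics.QuantumManyBody.BoseGas.periodicGroundStateEnergy v N L + ENNReal.ofReal t)) * ((∫⁻ Y in Literature.MathematicalPhysics.QuantumManyBody.BoseGas.cellN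 N L, Literature.MathematicalPhysics.QuantumManyBody.BoseGas.kineticDensity (fun Y' : Fin N → EuclideanSpace ℝ (Fin 3) => ((Real.sqrt ((N : ℝ) + 1) : ℝ) : ℂ) * ∫ x in Literature.MathematicalPhysics.QuantumManyBody.BoseGas.cell L, (starRingEnd ℂ) ((((Real.sqrt (L ^ 3))⁻¹ : ℝ) : ℂ) * Complex.exp (((2 * Real.pi * (∑ j : Fin 3, (q j : ℝ) * (⌊(K : ℝ) * x j / L⌋ : ℝ)) / (K : ℝ) : ℝ) : ℂ) * Complex.I)) * Ψ.ψ (Matrix.vecCons x Y')) Y + Literature.MathematicalPhysics.QuantumManyBody.BoseGas.periodicInteraction v L Y * (‖((Real.sqrt ((N : ℝ) + 1) : ℝ) : ℂ) * ∫ x in Literature.MathematicalPhysics.QuantumManyBody.BoseGas.cell L, (starRingEnd ℂ) ((((Real.sqrt (L ^ 3))⁻¹ : ℝ) : ℂ) * Complex.exp (((2 * Real.pi * (∑ j : Fin 3, (q j : ℝ) * (⌊(K : ℝ) * x j / L⌋ : ℝ)) / (K : ℝ) : ℝ) : ℂ) * Complex.I)) * Ψ.ψ (Matrix.vecCons x Y)‖₊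 : ENNReal) ^ 2) - Literature.MathematicalPhysics.QuantumManyBody.BoseGas.periodicGroundStateEnergy v N L * Literature.MathematicalPhysics.QuantumManyBody.BoseGas.cellOccupation (N + 1) L (fun x : EuclideanSpace ℝ (Fin 3) => (((Real.sqrt (L ^ 3))⁻¹ : ℝ) : ℂ) * Complex.exp (((2 * Real.pi * (∑ j : Fin 3, (q j : ℝ) * (⌊(K : ℝ) * x j / L⌋ : ℝ)) / (K : ℝ) : ℝ) : ℂ) * Complex.I)) Ψ.ψ + ENNReal.ofReal t * Literature.MathematicalPhysics.QuantumManyBody.BoseGas.cellOccupation (N + 1) L (fun x : EuclideanSpace ℝ (Fin 3) => (((Real.sqrt (L ^ 3))⁻¹ : ℝ) : ℂ) * Complex.exp (((2 * Real.pi * (∑ j : Fin 3, (q j : ℝ) * (⌊(K : ℝ) * x j / L⌋ : ℝ)) / (K : ℝ) : ℝ) : ℂ) * Complex.I)) Ψ.ψ)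

end __Registered

/-- The alias IS the stub statement (definitional unfolding; documentation only). [folklore] -/
example : __Registered.stub_annihilationEnergy ↔ (∀ v : ℝ → ENNReal, Literature.MathematicalPhysics.QuantumManyBody.BoseGas.IsRepulsiveFiniteRange v → ∀ A : ℝ, 0 < A → ∃ ρ₀ : ℝ, 0 < ρ₀ ∧ ∃ C : ℝ, 0 < C ∧ ∃ N₀ : ℕ, ∀ (N : ℕ) (L : ℝ), 0 < L → N₀ ≤ N → (N : ℝ) + 1 ≤ ρ₀ * L ^ 3 → ∃ δ : ENNReal, 0 < δ ∧ Literature.MathematicalPhysics.QuantumManyBody.BoseGas.periodicGroundStateEnergy v (N + 1) L ≠ ⊤ ∧ ∀ Ψ : Literature.MathematicalPhysics.QuantumManyBody.BoseGas.PeriodicTrialState (N + 1) L, Literature.MathematicalPhysics.QuantumManyBody.BoseGas.periodicEnergy v Ψ ≤ Literature.MathematicalPhysics.QuantumManyBody.BoseGas.periodicGroundStateEnergy v (N + 1) L + δ → ∀ K : ℕ, Even K → 0 < K → K ^ 3 ∣ (N + 1) → A / Real.sqrt (((N : ℝ) + 1) / L ^ 3) ≤ L / (K : ℝ) ∧ L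 / (K : ℝ) ≤ 2 * A / Real.sqrt (((N : ℝ) + 1) / L ^ 3) → ∀ q : Fin 3 → ℤ, ¬ (∀ j : Fin 3, (K : ℤ) ∣ q j) → (∫⁻ Y in Literature.MathematicalPhysics.QuantumManyBody.BoseGas.cellN N L, Literature.MathematicalPhysics.QuantumManyBody.BoseGas.kineticDensity (fun Y' : Fin N → EuclideanSpace ℝ (Fin 3) => ((Real.sqrt ((N : ℝ) + 1) : ℝ) : ℂ) * ∫ x in Literature.MathematicalPhysics.QuantumManyBody.BoseGas.cell L, (starRingEnd ℂ) ((((Real.sqrt (L ^ 3))⁻¹ : ℝ) : ℂ) * Complex.exp (((2 * Real.pi * (∑ j : Fin 3, (q j : ℝ) * (⌊(K : ℝ) * x j / L⌋ : ℝ)) / (K : ℝ) : ℝ) : ℂ) * Complex.I)) * Ψ.ψ (Matrix.vecCons x Y')) Y + Literature.MathematicalPhysics.QuantumManyBody.BoseGas.periodicInteraction v L Y * (‖((Real.sqrt ((N : ℝ) + 1) : ℝ) : ℂ) * ∫ x in Literature.MathematicalPhysics.QuantumManyBody.BoseGas.cell L, (starRingEnd ℂ) ((((Real.sqrt (L ^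 3))⁻¹ : ℝ) : ℂ) * Complex.exp (((2 * Real.pi * (∑ j : Fin 3, (q j : ℝ) * (⌊(K : ℝ) * x j / L⌋ : ℝ)) / (K : ℝ) : ℝ) : ℂ) * Complex.I)) * Ψ.ψ (Matrix.vecCons x Y)‖₊ : ENNReal) ^ 2) ≤ Literature.MathematicalPhysics.QuantumManyBody.BoseGas.periodicGroundStateEnergy v N L * Literature.MathematicalPhysics.QuantumManyBody.BoseGas.cellOccupation (N + 1) L (fun x : EuclideanSpace ℝ (Fin 3) => (((Real.sqrt (L ^ 3))⁻¹ : ℝ) : ℂ) * Complex.exp (((2 * Real.pi * (∑ j : Fin 3, (q j : ℝ) * (⌊(K : ℝ) * x j / L⌋ : ℝ)) / (K : ℝ) : ℝ) : ℂ) * Complex.I)) Ψ.ψ + ENNReal.ofReal (C / (L / (K : ℝ)) ^ 2)) := Iff.rfl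

/-- The alias IS the stub statement (definitional unfolding; documentation only). [folklore] -/
example : __Registered.stub_oneSidedKLS ↔ (∀ (v : ℝ → ENNReal) (N : ℕ) (L : ℝ), 0 < L → ∀ Ψ : Literature.MathematicalPhysics.QuantumManyBody.BoseGas.PeriodicTrialState (N + 1) L, Literature.MathematicalPhysics.QuantumManyBody.BoseGas.periodicEnergy v Ψ ≠ ⊤ → ∀ K : ℕ, 0 < K → ∀ (q : Fin 3 → ℤ) (t : ℝ), 0 < t → Literature.MathematicalPhysics.QuantumManyBody.BoseGas.cellOccupation (N + 1) L (fun x : EuclideanSpace ℝ (Fin 3) => (((Real.sqrt (L ^ 3))⁻¹ : ℝ) : ℂ) * Complex.exp (((2 * Real.pi * (∑ j : Fin 3, (q j : ℝ) * (⌊(K : ℝ) * x j / L⌋ : ℝ)) / (K : ℝ) : ℝ) : ℂ) * Complex.I)) Ψ.ψ ≠ ⊤ ∧ Literature.MathematicalPhysics.QuantumManyBody.BoseGas.cellOccupation (N + 1) L (fun x : EuclideanSpace ℝ (Fin 3) => (((Real.sqrt (L ^ 3))⁻¹ : ℝ) : ℂ) * Complex.exp (((2 * Real.pi * (∑ j :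 Fin 3, (q j : ℝ) * (⌊(K : ℝ) * x j / L⌋ : ℝ)) / (K : ℝ) : ℝ) : ℂ) * Complex.I)) Ψ.ψ ^ 2 ≤ (⨆ Φ : Literature.MathematicalPhysics.QuantumManyBody.BoseGas.PeriodicTrialState N L, ENNReal.ofReal (‖((Real.sqrt ((N : ℝ) + 1) : ℝ) : ℂ) * ∫ Y in Literature.MathematicalPhysics.QuantumManyBody.BoseGas.cellN N L, (starRingEnd ℂ) (Φ.ψ Y) * (∫ x in Literature.MathematicalPhysics.QuantumManyBody.BoseGas.cell L, (starRingEnd ℂ) ((((Real.sqrt (L ^ 3))⁻¹ : ℝ) : ℂ) * Complex.exp (((2 * Real.pi * (∑ j : Fin 3, (q j : ℝ) * (⌊(K : ℝ) * x j / L⌋ : ℝ)) / (K : ℝ) : ℝ) : ℂ) * Complex.I)) * Ψ.ψ (Matrix.vecCons x Y))‖ ^ 2) / (Literature.MathematicalPhysics.QuantumManyBody.BoseGas.periodicEnergy v Φ - Literature.MathematicalPhysics.QuantumManyBody.BoseGas.periodicGroundStateEnergy v N L + ENNReal.ofReal t)) * ((∫⁻ Y in Literature.MathematicalPhysics.QuantumManyBody.BoseGas.cellN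 N L, Literature.MathematicalPhysics.QuantumManyBody.BoseGas.kineticDensity (fun Y' : Fin N → EuclideanSpace ℝ (Fin 3) => ((Real.sqrt ((N : ℝ) + 1) : ℝ) : ℂ) * ∫ x in Literature.MathematicalPhysics.QuantumManyBody.BoseGas.cell L, (starRingEnd ℂ) ((((Real.sqrt (L ^ 3))⁻¹ : ℝ) : ℂ) * Complex.exp (((2 * Real.pi * (∑ j : Fin 3, (q j : ℝ) * (⌊(K : ℝ) * x j / L⌋ : ℝ)) / (K : ℝ) : ℝ) : ℂ) * Complex.I)) * Ψ.ψ (Matrix.vecCons x Y')) Y + Literature.MathematicalPhysics.QuantumManyBody.BoseGas.periodicInteraction v L Y * (‖((Real.sqrt ((N : ℝ) + 1) : ℝ) : ℂ) * ∫ x in Literature.MathematicalPhysics.QuantumManyBody.BoseGas.cell L, (starRingEnd ℂ) ((((Real.sqrt (L ^ 3))⁻¹ : ℝ) : ℂ) * Complex.exp (((2 * Real.pi * (∑ j : Fin 3, (q j : ℝ) * (⌊(K : ℝ) * x j / L⌋ : ℝ)) / (K : ℝ) : ℝ) : ℂ) * Complex.I)) * Ψ.ψ (Matrix.vecCons x Y)‖₊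 : ENNReal) ^ 2) - Literature.MathematicalPhysics.QuantumManyBody.BoseGas.periodicGroundStateEnergy v N L * Literature.MathematicalPhysics.QuantumManyBody.BoseGas.cellOccupation (N + 1) L (fun x : EuclideanSpace ℝ (Fin 3) => (((Real.sqrt (L ^ 3))⁻¹ : ℝ) : ℂ) * Complex.exp (((2 * Real.pi * (∑ j : Fin 3, (q j : ℝ) * (⌊(K : ℝ) * x j / L⌋ : ℝ)) / (K : ℝ) : ℝ) : ℂ) * Complex.I)) Ψ.ψ + ENNReal.ofReal t * Literature.MathematicalPhysics.QuantumManyBody.BoseGas.cellOccupation (N + 1) L (fun x : EuclideanSpace ℝ (Fin 3) => (((Real.sqrt (L ^ 3))⁻¹ : ℝ) : ℂ) * Complex.exp (((2 * Real.pi * (∑ j : Fin 3, (q j : ℝ) * (⌊(K : ℝ) * x j / L⌋ : ℝ)) / (K : ℝ) : ℝ) : ℂ) * Complex.I)) Ψ.ψ)) := Iff.rfl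


/-! ### Elementary lemmas used by the assembly (all sorry-free) -/

/-- `ε(q) = Σ_j (1 - cos(2π q_j / K)) ≤ 6`. [folklore] -/
theorem eps_le_six (q : Fin 3 → ℤ) (K : ℕ) :
    (∑ j : Fin 3, (1 - Real.cos (2 * Real.pi * (q j : ℝ) / (K : ℝ)))) ≤ 6 := by
  have h : ∀ j : Fin 3, (1 - Real.cos (2 * Real.pi * (q j : ℝ) / (K : ℝ))) ≤ 2 := fun j => by
    linarith [Real.neg_one_le_cos (2 * Real.pi * (q j : ℝ) / (K : ℝ))]
  calc (∑ j : Fin 3, (1 - Real.cos (2 * Real.pi * (q j : ℝ) / (K : ℝ))))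
      ≤ ∑ _j : Fin 3, (2 : ℝ) := Finset.sum_le_sum fun j _ => h j
    _ = 6 := by rw [Fin.sum_univ_three]; norm_num

/-- `ε(q) > 0` for `q ≢ 0 (mod K)`: `cos(2π q_j/K) = 1` forces `K ∣ q_j`. [folklore] -/
theorem eps_pos {q : Fin 3 → ℤ} {K : ℕ} (hK : 0 < K) (hq : ¬ (∀ j : Fin 3, (K : ℤ) ∣ q j)) :
    0 < (∑ j : Fin 3, (1 - Real.cos (2 * Real.pi * (q j : ℝ) / (K : ℝ)))) := by
  obtain ⟨j, hj⟩ := not_forall.mp hq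
  have hnn : ∀ i ∈ (Finset.univ : Finset (Fin 3)),
      0 ≤ (1 - Real.cos (2 * Real.pi * (q i : ℝ) / (K : ℝ))) := fun i _ => by
    linarith [Real.cos_le_one (2 * Real.pi * (q i : ℝ) / (K : ℝ))]
  have hjpos : 0 < 1 - Real.cos (2 * Real.pi * (q j : ℝ) / (K : ℝ)) := by
    rcases (Real.cos_le_one (2 * Real.pi * (q j : ℝ) / (K : ℝ))).lt_or_eq with hlt | heq
    · linarith
    · exfalso
      obtain ⟨n, hn⟩ := (Real.cos_eq_one_iff _).1 heq
      apply hj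
      refine ⟨n, ?_⟩
      have hKr : (K : ℝ) ≠ 0 := by exact_mod_cast hK.ne'
      have hπ : (2 * Real.pi) ≠ 0 := by positivity
      rw [eq_div_iff hKr] at hn
      have h2 : (2 * Real.pi) * (q j : ℝ) = (2 * Real.pi) * ((K : ℝ) * (n : ℝ)) := by
        linarith [hn]
      have h3 : (q j : ℝ) = (K : ℝ) * (n : ℝ) := mul_left_cancel₀ hπ h2
      exact_mod_cast h3
  exact lt_of_lt_of_le hjpos (Finset.single_le_sum hnn (Finset.mem_univ j))

/-- The `ℝ≥0∞` bookkeeping of the one-sided KLS transfer: from `n² ≤ b₋ (Q - E n + t n)`,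
`Q ≤ E n + Γ` and `b₋ + b₊ ≤ B` (with `n < ∞`) to the real inequality `n² ≤ B (Γ + t n)`. [folklore] -/
theorem ennreal_step {n bm bp Q E : ℝ≥0∞} {t Γ B : ℝ} (hn : n ≠ ⊤) (ht : 0 ≤ t) (hΓ : 0 ≤ Γ)
    (hB : 0 ≤ B) (hkls : n ^ 2 ≤ bm * (Q - E * n + ENNReal.ofReal t * n))
    (hc : Q ≤ E * n + ENNReal.ofReal Γ) (hb : bm + bp ≤ ENNReal.ofReal B) :
    n.toReal ^ 2 ≤ B * (Γ + t * n.toReal) := by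
  have h1 : Q - E * n ≤ ENNReal.ofReal Γ := by
    rw [tsub_le_iff_right, add_comm]
    exact hc
  have h2 : n ^ 2 ≤ ENNReal.ofReal B * (ENNReal.ofReal Γ + ENNReal.ofReal t * n) :=
    hkls.trans (mul_le_mul' (le_self_add.trans hb) (add_le_add h1 le_rfl))
  have hx : 0 ≤ n.toReal := ENNReal.toReal_nonneg
  rw [← ENNReal.ofReal_toReal hn] at h2
  rw [← ENNReal.ofReal_pow hx, ← ENNReal.ofReal_mul ht, ← ENNReal.ofReal_add hΓ (mul_nonneg ht hx),
    ← ENNReal.ofReal_mul hB] at h2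
  exact (ENNReal.ofReal_le_ofReal_iff (mul_nonneg hB (add_nonneg hΓ (mul_nonneg ht hx)))).1 h2

/-- The real arithmetic of the transfer: `x² ≤ (C₁ s/e)(C₂/s + (e/s) x)`, i.e.
`x² ≤ C₁C₂/e + C₁ x`, gives `x ≤ C₁ + √(C₁C₂/e) ≤ (√6 C₁ + √(C₁ C₂))/√e` for `0 < e ≤ 6`. [folklore] -/
theorem real_step {x C₁ C₂ s e : ℝ} (hx : 0 ≤ x) (hC₁ : 0 < C₁) (hC₂ : 0 < C₂) (hs : 0 < s)
    (he : 0 < e) (he6 : e ≤ 6) (h : x ^ 2 ≤ C₁ * s / e * (C₂ / s + e / s * x)) :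
    x ≤ (Real.sqrt 6 * C₁ + Real.sqrt (C₁ * C₂)) / Real.sqrt e := by
  have h' : x ^ 2 ≤ C₁ * C₂ / e + C₁ * x := by
    have hcalc : C₁ * s / e * (C₂ / s + e / s * x) = C₁ * C₂ / e + C₁ * x := by
      field_simp
    rw [hcalc] at h
    exact h
  set y := Real.sqrt (C₁ * C₂ / e) with hy
  have hy0 : 0 ≤ y := Real.sqrt_nonneg _
  have hyy : y ^ 2 = C₁ * C₂ / e := Real.sq_sqrt (by positivity)
  have hxy : x ≤ C₁ + y := by
    by_cases hle : x ≤ C₁ + y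
    · exact hle
    exfalso
    have hcon : C₁ + y < x := not_le.mp hle
    have hxpos : 0 < x := lt_of_le_of_lt (by positivity) hcon
    have h1 : x * (C₁ + y) < x * x := mul_lt_mul_of_pos_left hcon hxpos
    have h2 : y * y ≤ x * y := mul_le_mul_of_nonneg_right (by linarith) hy0
    nlinarith [h1, h2, hyy, h']
  have hsqe : 0 < Real.sqrt e := Real.sqrt_pos.2 he
  have h6 : Real.sqrt e ≤ Real.sqrt 6 := Real.sqrt_le_sqrt he6
  calc x ≤ C₁ + y := hxy
    _ ≤ Real.sqrt 6 * C₁ / Real.sqrt e + Real.sqrt (C₁ * C₂) / Real.sqrt e := by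
        apply add_le_add
        · rw [le_div_iff₀ hsqe]
          nlinarith [h6, hC₁]
        · rw [hy, Real.sqrt_div (by positivity : (0:ℝ) ≤ C₁ * C₂)]
    _ = (Real.sqrt 6 * C₁ + Real.sqrt (C₁ * C₂)) / Real.sqrt e := by rw [add_div]


/-! ### The assembly -/

/-- THE SKELETON THEOREM, HYPOTHESIS FORM (real proof, no `sorry`, axioms propext/Classical.choice/
Quot.sound): the three stub statements — each under its REGISTERED NAME: stub 1 is the route item
`BlockSusceptibilityBound` itself, stubs 2–3 enter as `__Registered.stub_annihilationEnergy` /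
`__Registered.stub_oneSidedKLS`, reducible aliases of their verbatim signatures — imply the crux
`BECIntegerBlockRotor.BlockInfraredBound` BY NAME. Bookkeeping: `N = M + 1`, `A :=` the block constant of #2, `C := √6·C_b + √(C_b·C_c)`,
`ρ₀ := min`, `N₀ := max + 1`, `δ := min (min δ_b δ_c) 1`; analysis: `ennreal_step`, `real_step`,
`eps_pos`, `eps_le_six`. [folklore] -/
theorem BlockInfraredBound_of :
    Summit.AtomisticToContinuum.BoseEinsteinCondensation.Theses.BECIntegerBlockRotor.BlockSusceptibilityBound →
    __Registered.stub_annihilationEnergy →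
    __Registered.stub_oneSidedKLS →
    Summit.AtomisticToContinuum.BoseEinsteinCondensation.Theses.BECIntegerBlockRotor.BlockInfraredBound := by
  intro hS1 hS2 hS3 v hv
  obtain ⟨ρ₁, hρ₁, A, hA, C₁, hC₁, N₁, H1⟩ := hS1 v hv
  obtain ⟨ρ₂, hρ₂, C₂, hC₂, N₂, H2⟩ := hS2 v hv A hA
  refine ⟨min ρ₁ ρ₂, lt_min hρ₁ hρ₂, A, hA, Real.sqrt 6 * C₁ + Real.sqrt (C₁ * C₂), by positivity,
    max N₁ N₂ + 1, ?_⟩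
  intro N L hL hN hρ
  obtain ⟨M, rfl⟩ : ∃ M, N = M + 1 := ⟨N - 1, by omega⟩
  have hM1 : N₁ ≤ M := by omega
  have hM2 : N₂ ≤ M := by omega
  have hcast : ((M + 1 : ℕ) : ℝ) = (M : ℝ) + 1 := by push_cast; ring
  rw [hcast] at hρ
  have hL3 : 0 < L ^ 3 := by positivity
  have hρ1 : (M : ℝ) + 1 ≤ ρ₁ * L ^ 3 :=
    hρ.trans (mul_le_mul_of_nonneg_right (min_le_left _ _) hL3.le)
  have hρ2 : (M : ℝ) + 1 ≤ ρ₂ * L ^ 3 :=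
    hρ.trans (mul_le_mul_of_nonneg_right (min_le_right _ _) hL3.le)
  obtain ⟨δ₁, hδ₁, H1'⟩ := H1 M L hL hM1 hρ1
  obtain ⟨δ₂, hδ₂, hE0, H2'⟩ := H2 M L hL hM2 hρ2
  refine ⟨min (min δ₁ δ₂) 1, lt_min (lt_min hδ₁ hδ₂) zero_lt_one, ?_⟩
  intro Ψ hΨ K hKe hK hKd hwin q hq
  rw [hcast] at hwin
  have hΨ1 : Literature.MathematicalPhysics.QuantumManyBody.BoseGas.periodicEnergy v Ψ ≤ Literature.MathematicalPhysics.QuantumManyBody.BoseGas.periodicGroundStateEnergy v (M + 1) L + δ₁ :=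
    hΨ.trans (add_le_add le_rfl ((min_le_left _ _).trans (min_le_left _ _)))
  have hΨ2 : Literature.MathematicalPhysics.QuantumManyBody.BoseGas.periodicEnergy v Ψ ≤ Literature.MathematicalPhysics.QuantumManyBody.BoseGas.periodicGroundStateEnergy v (M + 1) L + δ₂ :=
    hΨ.trans (add_le_add le_rfl ((min_le_left _ _).trans (min_le_right _ _)))
  have hδfin : min (min δ₁ δ₂) (1 : ℝ≥0∞) ≠ ⊤ := ne_top_of_le_ne_top ENNReal.one_ne_top (min_le_right _ _)
  have hΨfin : Literature.MathematicalPhysics.QuantumManyBody.BoseGas.periodicEnergy v Ψ ≠ ⊤ :=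
    ne_top_of_le_ne_top (ENNReal.add_ne_top.2 ⟨hE0, hδfin⟩) hΨ
  have hb := H1' Ψ hΨ1 K hKe hK hKd hwin q hq
  have hc := H2' Ψ hΨ2 K hKe hK hKd hwin q hq
  have hKr : (0 : ℝ) < (K : ℝ) := Nat.cast_pos.mpr hK
  have hl : 0 < L / (K : ℝ) := div_pos hL hKr
  have hl2 : 0 < (L / (K : ℝ)) ^ 2 := pow_pos hl 2
  have heps : 0 < (∑ j : Fin 3, (1 - Real.cos (2 * Real.pi * (q j : ℝ) / (K : ℝ)))) := eps_pos hK hq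
  have heps6 : (∑ j : Fin 3, (1 - Real.cos (2 * Real.pi * (q j : ℝ) / (K : ℝ)))) ≤ 6 := eps_le_six q K
  have ht : 0 < (∑ j : Fin 3, (1 - Real.cos (2 * Real.pi * (q j : ℝ) / (K : ℝ)))) / (L / (K : ℝ)) ^ 2 := div_pos heps hl2
  obtain ⟨hnfin, hkls⟩ := hS3 v M L hL Ψ hΨfin K hK q ((∑ j : Fin 3, (1 - Real.cos (2 * Real.pi * (q j : ℝ) / (K : ℝ)))) / (L / (K : ℝ)) ^ 2) ht
  have hx := ennreal_step hnfin ht.le (div_nonneg hC₂.le hl2.le)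
    (div_nonneg (mul_nonneg hC₁.le hl2.le) heps.le) hkls hc hb
  have hfinal := real_step ENNReal.toReal_nonneg hC₁ hC₂ hl2 heps heps6 hx
  calc Literature.MathematicalPhysics.QuantumManyBody.BoseGas.cellOccupation (M + 1) L (fun x : EuclideanSpace ℝ (Fin 3) => (((Real.sqrt (L ^ 3))⁻¹ : ℝ) : ℂ) * Complex.exp (((2 * Real.pi * (∑ j : Fin 3, (q j : ℝ) * (⌊(K : ℝ) * x j / L⌋ : ℝ)) / (K : ℝ) : ℝ) : ℂ) * Complex.I)) Ψ.ψ
      = ENNReal.ofReal (Literature.MathematicalPhysics.QuantumManyBody.BoseGas.cellOccupation (M + 1) L (fun x : EuclideanSpace ℝ (Fin 3) => (((Real.sqrt (L ^ 3))⁻¹ : ℝ) : ℂ) * Complex.exp (((2 * Real.pi * (∑ j : Fin 3, (q j : ℝ) * (⌊(K : ℝ) * x j / L⌋ : ℝ)) / (K : ℝ) : ℝ) : ℂ) * Complex.I)) Ψ.ψ).toReal := (ENNReal.ofReal_toReal hnfin).symm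
    _ ≤ _ := ENNReal.ofReal_le_ofReal hfinal

/-- THE SKELETON THEOREM, CLOSED FORM: the crux `BECIntegerBlockRotor.BlockInfraredBound` from the
three declared stubs (its only `sorry`s are the stubs'; the composition is `BlockInfraredBound_of`). [folklore] -/
theorem BlockInfraredBound_of_stubs : Summit.AtomisticToContinuum.BoseEinsteinCondensation.Theses.BECIntegerBlockRotor.BlockInfraredBound :=
  BlockInfraredBound_of stub_blockSusceptibility stub_annihilationEnergy stub_oneSidedKLS

end Summit.AtomisticToContinuum.BoseEinsteinCondensation.Cruxes.BlockInfraredBound.Birth
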